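import Summits.QuantumFields.YangMills.Theses.PencilRigidity
import Summits.QuantumFields.YangMills.Theses.CoincidenceRotationBootstrap
import Summits.QuantumFields.YangMills.Theorems.HypercubicLimit.Negative.ExtendByZero
import Summits.QuantumFields.YangMills.Theorems.CoincidenceRotationBootstrapHypercubicLimitOneFieldWeak

/-!
# `PencilRigidity.WeakCouplingHypercubicLimit` (stmt-QuantumFields-16120) is, BY NAME, the existence leg
# `CoincidenceRotationBootstrap.HypercubicLimit` (stmt-QuantumFields-16154, shared with `MirrorModularBoosts`)

Three E1-routes of the sub-problem import the same open existence-minus-rotations leg at weak coupling: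
`PencilRigidity.WeakCouplingHypercubicLimit` (stmt-16120, typed in ONE-FIELD GAUGE: every species string
with a non-curvature entry vanishes) and `CoincidenceRotationBootstrap.HypercubicLimit` =
`MirrorModularBoosts.WeakCouplingHypercubicLimit` (stmt-16154, the same clauses without the one-field
clause).  This file records the identification kernel-checked and by name, so that ONE closure (or one
refutation) of either decl serves all three routes:

* `stub_siblingTie` / `weakCouplingHypercubicLimit_iff_coincidenceRotationBootstrap` — stmt-16120 ⇔ stmt-16154 (CRB spelling):
  `→` forget the one-field clause; `←` silence every non-curvature species (a structure update of the
  scheme keeping `a, β, L, m`, so `HasWeakCouplingLimit` and `HasLatticeMassGap` are untouched) and replace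
  the family by the extension by zero of its curvature channel (`Negative/ExtendByZero`: every OS clause,
  the continuum gap, non-triviality and non-Gaussianity survive).
(The `MirrorModularBoosts` spelling of stmt-16154 is the same text; its route module's farm olean still
predates the 2026-08-16 re-type — the decl is unknown to `lean check` today — so the by-name identification
with that spelling is left to a one-line `Iff.rfl` once the module builds.  The summit tie
`YangMills → PencilRigidity.WeakCouplingHypercubicLimit` is the landed `Negative/SummitTie`, contrapositive.)

No new definitions. [folklore]
-/

noncomputable section

open scoped SchwartzMap
open MeasureTheory Filter Topology Complex
open Literature.MathematicalPhysics.AQFT Literature.MathematicalPhysics.QuantumLattice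
open Literature.MathematicalPhysics.QuantumFieldTheory
open Summit.QuantumFields.YangMills.Theorems.HypercubicLimit.Negative
open Summit.QuantumFields.YangMills.Theorems.HypercubicLimit.OneFieldWeak

namespace Summit.QuantumFields.YangMills.Theorems.WeakCouplingHypercubicLimit.SiblingTie

/-- **stmt-16120 ⇔ stmt-16154** (`CoincidenceRotationBootstrap.HypercubicLimit`): the one-field clause of
`PencilRigidity.WeakCouplingHypercubicLimit` carries no weight — forget it one way; silence the non-curvature
species and extend the curvature channel by zero the other way. [folklore] -/
theorem weakCouplingHypercubicLimit_iff_coincidenceRotationBootstrap :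
    Summit.QuantumFields.YangMills.Theses.PencilRigidity.WeakCouplingHypercubicLimit ↔
      Summit.QuantumFields.YangMills.Theses.CoincidenceRotationBootstrap.HypercubicLimit := by
  constructor
  · intro h G _ _ _ _ hG
    letI : MeasurableSpace G := borel G
    haveI : BorelSpace G := ⟨rfl⟩
    obtain ⟨r, sch, S, hw, -, hos, hconv, hnt, hng, hgaps⟩ := h G hG
    exact ⟨r, sch, S, hw, hos, hconv, hnt, hng, hgaps⟩
  · intro h G _ _ _ _ hG
    letI : MeasurableSpace G := borel G
    haveI : BorelSpace G := ⟨rfl⟩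
    obtain ⟨r, sch, S, hw, hos, hconv, hnt, hng, Δ, hΔ, hgap, hlat⟩ := h G hG
    refine ⟨r, { sch with c := fun s k => by classical exact if s = r.curvature then sch.c s k else 0 },
      extendByZero r.curvature (restrictTo r.curvature S), hw, ?_,
      osClauses_extendByZero (osClauses_restrictTo _ hos), ?_, ?_, ?_, Δ, hΔ,
      hasMassGap_extendByZero (hasMassGap_restrictTo _ hgap), hlat⟩
    · -- one-field gauge
      rintro n k ⟨i, hi⟩ F
      rw [extendByZero_of_not_all _ _ (fun hall => hi (hall i))]
      rfl
    · -- convergence along the silenced scheme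
      intro n hn σ f F hF hod
      by_cases hσ : ∀ i, σ i = r.curvature
      · obtain rfl : σ = fun _ => r.curvature := funext hσ
        rw [extendByZero_const]
        simp_rw [latticeSchwinger_silence_self]
        exact hconv n hn _ f F hF hod
      · push Not at hσ
        obtain ⟨i₀, hi₀⟩ := hσ
        rw [extendByZero_of_not_all _ _ (fun hall => hi₀ (hall i₀))]
        simp_rw [latticeSchwinger_silence_of_ne r sch r.curvature _ n σ f hi₀]
        simp
    · -- non-triviality of the curvature channel
      simpa [restrictTo] using hnt
    · -- non-Gaussianity of the curvature channel
      simpa [restrictTo] using hng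

/-- `stub_siblingTie` (registered sub-goal of stmt-16120): **stmt-16120 ⇔ stmt-16154 by name** — one
closure or one refutation of either existence leg serves PencilRigidity, CoincidenceRotationBootstrap and
MirrorModularBoosts alike. [folklore] -/
theorem stub_siblingTie :
    Summit.QuantumFields.YangMills.Theses.PencilRigidity.WeakCouplingHypercubicLimit ↔
      Summit.QuantumFields.YangMills.Theses.CoincidenceRotationBootstrap.HypercubicLimit :=
  weakCouplingHypercubicLimit_iff_coincidenceRotationBootstrap

end Summit.QuantumFields.YangMills.Theorems.WeakCouplingHypercubicLimit.SiblingTie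

end
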